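import Literature.Computability.Complexity.NTIMEMono
import Literature.Computability.Complexity.StackBricksArith
import HarnessLib

/-!
# Closure properties of time-constructible functions: numeral maps, powers, linear
# substitution, composition, products

Literature / complexity toolkit (Arora–Barak 2009, §1.3: "the class of time-constructible
functions is robust", examples `n`, `n log n`, `n²`, `2ⁿ`; Sipser, Def. 9.8). The tree's
`IsTimeConstructible t` (`Classes.lean`, Sipser's binary-output form: `n ≤ t n` and
`1ⁿ ↦ ⌞t n⌟` computable by a `TM2` machine within `c · t n + c` steps) had exactly one closure
lemma, `IsTimeConstructible.mul_add` (`NTIMEMono.lean`: `n ↦ c · t n + c`). This file proves the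
standard ones, all as theorems over Mathlib's `TM2` model:

* `IsTimeConstructible.of_numeralMap` — `n ↦ φ (t n)` for any `FP` map of numerals
  `⌞T⌟ ↦ ⌞φ T⌟` with `T ≤ φ T` (the machine of `t` followed by the numeral map, whose time is a
  polynomial in `|⌞t n⌟| ≤ log₂ (t n) + 1`, hence `O(t n)`; the proof of `mul_add` verbatim);
* `IsTimeConstructible.pow` — `n ↦ (t n)^D`, `1 ≤ D` (the numeral map `powNumFn D`, iterated
  product brick `Brick.prodFn`);
* `IsTimeConstructible.comp_mul_left` — `n ↦ t (c · n)`, `1 ≤ c` (the linear-time stack program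
  `TCClosure.stretchProg`: `x ↦ 1^{c |x|}`, then the machine of `t`);
* `IsTimeConstructible.comp` — `n ↦ t₂ (t₁ n)` (the unary clock of `t₁`,
  `exists_unaryClock_of_timeConstructible`: `1ⁿ ↦ ⟨1ⁿ, 1^{t₁ n}⟩`; the projection
  `TCClosure.sndProg`: `⟨gs, x⟩ ↦ x`; the machine of `t₂`; `t₁ n ≤ t₂ (t₁ n)` absorbs the clock);
* `IsTimeConstructible.mul` — `n ↦ t₁ n · t₂ n` (copy `1ⁿ ↦ ⟨1ⁿ, 1ⁿ⟩` by `UnaryClock.pre`, run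
  the machine of `t₁` on the first component under `mapFstAux`, swap the pair by
  `TCClosure.swapProg`, run the machine of `t₂` on the first component, multiply the two
  numerals with `Brick.prodFn` — a polynomial in their logarithmic lengths,
  `exists_eval_pairLen_le_mul`).

The stack programs are written in the structured language `ACom` of `SymbolPrograms.lean` over
the register file `UnaryClock.Rg` of `NTIMEHierarchyClock.lean`, reusing its pair parser
`UnaryClock.parse`; `ACom.exists_computesInTime` turns them into `TM2` machines with exact step
counts, and `Turing.TM2ComputableAux.comp_outputsWithin` (`TimeBoundsProofs.lean`) composes
machines with additive time. Consumers: the move-length bookkeeping of Murray–Williams 2018,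
Lemma 4.1 (`MurrayWilliams2018EasyWitnessAssembly.lean`: `s(e·n)`, `s ∘ s^{D'}`, products and
powers of these), and any clocked simulation at a composite time bound.

Mathlib has no time-constructible functions (searched `TimeConstructible`, `time_constructible`);
the tree had `IsTimeConstructible.mul_add`, `isTimeConstructible_id/linear/two_pow/…` for
specific functions only (`lean search`, 2026-08-15).

## References

* S. Arora, B. Barak, *Computational Complexity: A Modern Approach*, CUP 2009, §1.3 (p. 16:
  time-constructible functions; robustness of the model, Claim 1.6), Thm. 2.8 / Ex. 2.9
  [AroraBarakCC2009].
* M. Sipser, *Introduction to the Theory of Computation*, 3rd ed., Def. 9.8.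
* T. Nipkow, G. Klein, *Concrete Semantics with Isabelle/HOL*, Springer 2014, Ch. 7 (big-step
  reasoning about the stack programs; `SymbolPrograms.lean`).
-/

namespace Literature.Computability.Complexity

open _root_.Computability Turing Polynomial

/-! ### Numeral maps: `n ↦ φ (t n)` for an `FP` map `⌞T⌟ ↦ ⌞φ T⌟` with `T ≤ φ T` -/

/-- **Time-constructible functions are closed under polynomial-time numeral maps.** If `t` is
time constructible, `F ∈ FP` maps the numeral of every `T` to the numeral of `φ T`, and
`T ≤ φ T`, then `n ↦ φ (t n)` is time constructible: follow the machine `1ⁿ ↦ ⌞t n⌟` by the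
machine of `F`, whose time is a polynomial in `|⌞t n⌟| ≤ log₂ (t n) + 1`, hence `O(t n)`.
(The proof of `IsTimeConstructible.mul_add` in `NTIMEMono.lean`, with the affine map replaced
by `F`.) [cite: AroraBarakCC2009, §1.3 (p. 16)] -/
theorem IsTimeConstructible.of_numeralMap {t : ℕ → ℕ} (ht : IsTimeConstructible t)
    {φ : ℕ → ℕ} {F : List Bool → List Bool} (hF : F ∈ FP)
    (hFval : ∀ T : ℕ, F (encodeNat T) = encodeNat (φ T)) (hφ : ∀ T, T ≤ φ T) :
    IsTimeConstructible fun n => φ (t n) := by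
  obtain ⟨hge, ct, Mt, hMt⟩ := ht
  refine ⟨fun n => (hge n).trans (hφ _), ?_⟩
  obtain ⟨p, MA, hMA⟩ := hF
  obtain ⟨c₁, k, hk⟩ := exists_eval_le_mul_pow_add p
  obtain ⟨C, hC⟩ := TimeConstructible.exists_pow_le_mul_two_pow k
  refine ⟨ct + 2 * (c₁ * C) + c₁, Mt.comp MA, fun n => ?_⟩
  have hl : (unaryEncodeNat n).length = n := unary_decode_encode_nat n
  have h1 : Mt.OutputsWithin (unaryEncodeNat n) (encodeNat (t n)) (ct * t n + ct) := by
    have := hMt n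
    dsimp only at this
    rwa [hl] at this
  have h2 : MA.OutputsWithin (encodeNat (t n)) (encodeNat (φ (t n)))
      (p.eval (encodeNat (t n)).length) := by
    have := hMA (encodeNat (t n))
    rwa [hFval] at this
  have h := Turing.TM2ComputableAux.comp_outputsWithin _ _ h1 h2
  dsimp only
  rw [hl]
  refine h.mono ?_
  have hm : (encodeNat (t n)).length ≤ Nat.log 2 (t n) + 1 := TM2Pass.length_encodeNat_le (t n)
  have h2m : 2 ^ (encodeNat (t n)).length ≤ 2 * (t n + 1) :=
    calc 2 ^ (encodeNat (t n)).length ≤ 2 ^ (Nat.log 2 (t n) + 1) :=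
          Nat.pow_le_pow_right Nat.two_pos hm
      _ = 2 * 2 ^ Nat.log 2 (t n) := by rw [pow_succ, mul_comm]
      _ ≤ 2 * (t n + 1) := Nat.mul_le_mul_left 2 (Nat.pow_log_le_add_one 2 (t n))
  have hp : p.eval (encodeNat (t n)).length ≤ c₁ * (C * (2 * (t n + 1))) + c₁ :=
    (hk _).trans (by
      gcongr
      exact (hC _).trans (Nat.mul_le_mul_left C h2m))
  have hTΦ : t n ≤ φ (t n) := hφ _
  have e1 : c₁ * (C * (2 * (t n + 1))) = 2 * (c₁ * C) * t n + 2 * (c₁ * C) := by ring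
  have e2 : (ct + 2 * (c₁ * C) + c₁) * φ (t n) =
      ct * φ (t n) + 2 * (c₁ * C) * φ (t n) + c₁ * φ (t n) := by ring
  have hK1 : ct * t n ≤ ct * φ (t n) := Nat.mul_le_mul_left _ hTΦ
  have hK2 : 2 * (c₁ * C) * t n ≤ 2 * (c₁ * C) * φ (t n) := Nat.mul_le_mul_left _ hTΦ
  omega

/-! ### Powers -/

/-- The numeral map of the `D`-th power: `⌞T⌟ ↦ ⌞T ^ D⌟`, from the product brick. [folklore] -/
noncomputable def powNumFn : ℕ → (List Bool → List Bool)
  | 0 => fun _ => encodeNat 1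
  | D + 1 => Brick.prodFn ∘ fanoutFn (powNumFn D) id

/-- `powNumFn D ∈ FP`. [folklore] -/
theorem powNumFn_mem_FP : ∀ D : ℕ, powNumFn D ∈ FP
  | 0 => const_mem_FP _
  | D + 1 => comp_mem_FP Brick.prodFn_mem_FP
      (fanoutFn_mem_FP (powNumFn_mem_FP D) (PolyTimeComputable.id _))

/-- `powNumFn D ⌞T⌟ = ⌞T ^ D⌟`. [folklore] -/
theorem powNumFn_encodeNat : ∀ (D T : ℕ), powNumFn D (encodeNat T) = encodeNat (T ^ D)
  | 0, T => by simp [powNumFn]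
  | D + 1, T => by
    simp only [powNumFn, Function.comp_apply, fanoutFn_apply, id, powNumFn_encodeNat D T,
      Brick.prodFn_boolPair, bitsToNat_encodeNat, pow_succ]

/-- **Powers of a time-constructible function are time constructible** (`1 ≤ D`).
[cite: AroraBarakCC2009, §1.3 (p. 16)] -/
theorem IsTimeConstructible.pow {t : ℕ → ℕ} (ht : IsTimeConstructible t) {D : ℕ} (hD : 1 ≤ D) :
    IsTimeConstructible fun n => t n ^ D :=
  ht.of_numeralMap (powNumFn_mem_FP D) (powNumFn_encodeNat D) fun T =>
    Nat.le_self_pow (by omega) T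

/-! ### Linear substitution `n ↦ t (c · n)` -/

namespace TCClosure

open UnaryClock ACom

/-- `stretch c`: replace every input symbol by `c` ones: `x ↦ 1^{c |x|}`. [folklore] -/
def stretchProg (c : ℕ) : Prog := loop .inp fun _ => pushList .out (List.replicate c true)

/-- Effect and cost of `stretchProg c`: `(c + 2) |x| + 1` steps. [folklore] -/
theorem runs_stretchProg (c : ℕ) (x : List Bool) :
    Runs (stretchProg c) (mk x [] [] [] [] []) (mk [] [] [] [] [] (un (c * x.length)))
      ((c + 2) * x.length + 1) := by
  have h := runs_loop_inv (k := Rg.inp) (f := fun _ => pushList .out (List.replicate c true))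
    (fun done rest => mk rest [] [] [] [] (un (c * done.length)))
    (fun _ _ => True) c
    (fun _ _ _ => rfl)
    (fun done a rest _ => ⟨trivial, by
      have := runs_pushList (Γ := Bool) Rg.out (List.replicate c true)
        (Function.update (mk (a :: rest) [] [] [] [] (un (c * done.length))) Rg.inp rest)
      refine this.of_eq ?_ (by simp)
      simp only [update_mk_inp, mk_out, update_mk_out, List.reverse_replicate, List.length_cons,
        un, List.replicate_append_replicate]
      congr 2
      ring⟩)
    x [] trivial
  unfold stretchProg
  simpa [un] using h

/-- **The machine of `stretchProg`**: `x ↦ 1^{c |x|}` within `(c + 2) |x| + 2` steps. [folklore] -/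
theorem exists_machine_stretch (c : ℕ) : ∃ M : TM2ComputableAux Bool Bool, ∀ x : List Bool,
    M.OutputsWithin x (un (c * x.length)) ((c + 2) * x.length + 2) := by
  obtain ⟨M, hM⟩ := ACom.exists_computesInTime (stretchProg c) .inp .out
    (id : List Bool → List Bool) id (fun x => un (c * x.length)) (fun x => (c + 2) * x.length + 1)
    (fun x => by rw [single_inp, single_out]; exact runs_stretchProg c x)
  exact ⟨M, fun x => hM x⟩

end TCClosure

/-- **Linear substitution**: if `t` is time constructible and `1 ≤ c` then so is
`n ↦ t (c · n)` — write `1^{c n}` (linear time) and run the constructor of `t`.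
[cite: AroraBarakCC2009, §1.3 (p. 16)] -/
theorem IsTimeConstructible.comp_mul_left {t : ℕ → ℕ} (ht : IsTimeConstructible t) {c : ℕ}
    (hc : 1 ≤ c) : IsTimeConstructible fun n => t (c * n) := by
  obtain ⟨hge, ct, Mt, hMt⟩ := ht
  obtain ⟨M₁, hM₁⟩ := TCClosure.exists_machine_stretch c
  refine ⟨fun n => (Nat.le_mul_of_pos_left n hc).trans (hge _), ct + c + 3, M₁.comp Mt,
    fun n => ?_⟩
  have hl : (unaryEncodeNat n).length = n := unary_decode_encode_nat n
  dsimp only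
  rw [hl]
  have h1 : M₁.OutputsWithin (unaryEncodeNat n) (UnaryClock.un (c * n)) ((c + 2) * n + 2) := by
    have := hM₁ (unaryEncodeNat n)
    rwa [hl] at this
  have h2 : Mt.OutputsWithin (UnaryClock.un (c * n)) (encodeNat (t (c * n))) (ct * t (c * n) + ct) := by
    have := hMt (c * n)
    have hl' : (unaryEncodeNat (c * n)).length = c * n := unary_decode_encode_nat _
    dsimp only at this
    rwa [hl', UnaryClock.unaryEncodeNat_eq_un] at this
  have h := Turing.TM2ComputableAux.comp_outputsWithin _ _ h1 h2
  refine h.mono ?_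
  have hcn : c * n ≤ t (c * n) := hge _
  have hn : n ≤ c * n := Nat.le_mul_of_pos_left n hc
  have e : (ct + c + 3) * t (c * n) = ct * t (c * n) + (c + 2) * t (c * n) + t (c * n) := by ring
  have : (c + 2) * n ≤ (c + 2) * t (c * n) := Nat.mul_le_mul_left _ (hn.trans hcn)
  omega

/-! ### Composition `n ↦ t₂ (t₁ n)` -/

namespace TCClosure

open UnaryClock ACom

/-- `sndProg`: the second component of a pair word, `⟨gs, x⟩ ↦ x` (parse the pair with
`UnaryClock.parse`, pour the reversed payload to the output, discard the first component).
[folklore] -/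
def sndProg : Prog := parse ;; pour .xr .out ;; clear .br

/-- Effect and cost of `sndProg`: `7 |gs| + 6 |x| + 8` steps. [folklore] -/
theorem runs_sndProg (gs x : List Bool) :
    Runs sndProg (mk (boolPair gs x) [] [] [] [] []) (mk [] [] [] [] [] x)
      (7 * gs.length + 6 * x.length + 8) := by
  unfold sndProg
  have h1 := runs_parse x gs []
  have h2 := runs_pour (Γ := Bool) (a := Rg.xr) (b := Rg.out) (by decide)
    (mk [] x.reverse (gs.reverse ++ []) [] [] [])
  simp only [mk_xr, mk_out, List.reverse_reverse, List.append_nil, update_mk_xr, update_mk_out,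
    List.length_reverse] at h2
  have h3 := runs_clear (Γ := Bool) Rg.br (mk [] [] gs.reverse [] [] x)
  simp only [mk_br, update_mk_br, List.length_reverse] at h3
  simp only [List.append_nil] at h1
  exact (h1.seq (h2.seq h3)).of_eq rfl (by omega)

/-- **The machine of `sndProg`**: `⟨gs, x⟩ ↦ x` within `7 |gs| + 6 |x| + 9` steps. [folklore] -/
theorem exists_machine_snd : ∃ M : TM2ComputableAux Bool Bool, ∀ gs x : List Bool,
    M.OutputsWithin (boolPair gs x) x (7 * gs.length + 6 * x.length + 9) := by
  obtain ⟨M, hM⟩ := ACom.exists_computesInTime sndProg .inp .out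
    (fun p : List Bool × List Bool => boolPair p.1 p.2) id Prod.snd
    (fun p => 7 * p.1.length + 6 * p.2.length + 8)
    (fun p => by rw [single_inp, single_out]; exact runs_sndProg p.1 p.2)
  exact ⟨M, fun gs x => hM (gs, x)⟩

end TCClosure

/-- **Composition**: if `t₁` and `t₂` are time constructible then so is `n ↦ t₂ (t₁ n)` — the
unary clock of `t₁` (`1ⁿ ↦ ⟨1ⁿ, 1^{t₁ n}⟩`, `exists_unaryClock_of_timeConstructible`), the
projection to `1^{t₁ n}`, and the constructor of `t₂`; the time is `O(t₁ n) + O(t₂ (t₁ n))`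
and `t₁ n ≤ t₂ (t₁ n)`. [cite: AroraBarakCC2009, §1.3 (p. 16)] -/
theorem IsTimeConstructible.comp {t₁ t₂ : ℕ → ℕ} (h₁ : IsTimeConstructible t₁)
    (h₂ : IsTimeConstructible t₂) : IsTimeConstructible fun n => t₂ (t₁ n) := by
  obtain ⟨N, a, hN⟩ := exists_unaryClock_of_timeConstructible h₁
  obtain ⟨hge₁, -⟩ := h₁
  obtain ⟨hge₂, c₂, M₂, hM₂⟩ := h₂
  obtain ⟨Ms, hMs⟩ := TCClosure.exists_machine_snd
  refine ⟨fun n => (hge₁ n).trans (hge₂ _), a + c₂ + 22, N.comp (Ms.comp M₂), fun n => ?_⟩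
  have hl : (unaryEncodeNat n).length = n := unary_decode_encode_nat n
  dsimp only
  rw [hl]
  have h1 : N.OutputsWithin (unaryEncodeNat n)
      (boolPair (unaryEncodeNat n) (List.replicate (t₁ n) true)) (a * t₁ n + a) := by
    have := hN (unaryEncodeNat n)
    rwa [hl] at this
  have h2 : Ms.OutputsWithin (boolPair (unaryEncodeNat n) (List.replicate (t₁ n) true))
      (List.replicate (t₁ n) true) (7 * n + 6 * t₁ n + 9) := by
    have := hMs (unaryEncodeNat n) (List.replicate (t₁ n) true)
    rwa [hl, List.length_replicate] at this
  have h3 : M₂.OutputsWithin (List.replicate (t₁ n) true) (encodeNat (t₂ (t₁ n)))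
      (c₂ * t₂ (t₁ n) + c₂) := by
    have := hM₂ (t₁ n)
    have hl' : (unaryEncodeNat (t₁ n)).length = t₁ n := unary_decode_encode_nat _
    dsimp only at this
    rwa [hl', UnaryClock.unaryEncodeNat_eq_un] at this
  have h := Turing.TM2ComputableAux.comp_outputsWithin _ _ h1
    (Turing.TM2ComputableAux.comp_outputsWithin _ _ h2 h3)
  refine h.mono ?_
  have hn : n ≤ t₁ n := hge₁ n
  have h12 : t₁ n ≤ t₂ (t₁ n) := hge₂ _
  have e : (a + c₂ + 22) * t₂ (t₁ n) = a * t₂ (t₁ n) + c₂ * t₂ (t₁ n) + 22 * t₂ (t₁ n) := by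
    ring
  have ha : a * t₁ n ≤ a * t₂ (t₁ n) := Nat.mul_le_mul_left a h12
  omega

/-! ### Products `n ↦ t₁ n · t₂ n` -/

namespace TCClosure

open UnaryClock ACom

/-- `swapProg`: swap the components of a pair word, `⟨gs, x⟩ ↦ ⟨x, gs⟩` (parse, emit the first
component, the separator, and the doubled second component). [folklore] -/
def swapProg : Prog :=
  parse ;; pour .br .out ;; push .out true ;; push .out false ;;
    loop .xr fun b => push .out b ;; push .out b

/-- Effect and cost of the doubling stage of `swapProg`. [folklore] -/
theorem runs_swap_tokens (o : List Bool) (xr : List Bool) :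
    Runs (loop .xr fun b => push .out b ;; push .out b) (mk [] xr [] [] [] o)
      (mk [] [] [] [] [] ((xr.reverse.flatMap fun b => [b, b]) ++ o)) (4 * xr.length + 1) := by
  have h := runs_loop_inv (k := Rg.xr) (f := fun b => push .out b ;; push .out b)
    (fun done rest => mk [] rest [] [] [] ((done.flatMap fun b => [b, b]) ++ o))
    (fun _ _ => True) 2
    (fun _ _ _ => rfl)
    (fun done a rest _ => ⟨trivial, by
      refine ((Runs.push' rfl).seq (Runs.push' ?_)).of_eq rfl (by norm_num)
      simp only [update_mk_xr, update_mk_out, mk_out, List.flatMap_cons, List.cons_append,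
        List.nil_append]⟩)
    xr [] trivial
  simpa using h

/-- Effect and cost of `swapProg`: `8 |gs| + 7 |x| + 10` steps. [folklore] -/
theorem runs_swapProg (gs x : List Bool) :
    Runs swapProg (mk (boolPair gs x) [] [] [] [] []) (mk [] [] [] [] [] (boolPair x gs))
      (8 * gs.length + 7 * x.length + 10) := by
  unfold swapProg
  have h1 := runs_parse x gs []
  simp only [List.append_nil] at h1
  have h2 := runs_pour (Γ := Bool) (a := Rg.br) (b := Rg.out) (by decide)
    (mk [] x.reverse gs.reverse [] [] [])
  simp only [mk_br, mk_out, List.reverse_reverse, List.append_nil, update_mk_br, update_mk_out,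
    List.length_reverse] at h2
  have h3 : Runs (push Rg.out true) (mk [] x.reverse [] [] [] gs)
      (mk [] x.reverse [] [] [] (true :: gs)) 1 := Runs.push' (by simp)
  have h4 : Runs (push Rg.out false) (mk [] x.reverse [] [] [] (true :: gs))
      (mk [] x.reverse [] [] [] (false :: true :: gs)) 1 := Runs.push' (by simp)
  have h5 := runs_swap_tokens (false :: true :: gs) x.reverse
  simp only [List.reverse_reverse, List.length_reverse] at h5
  have hout : (x.flatMap fun b => [b, b]) ++ false :: true :: gs = boolPair x gs := by
    simp [boolPair]
  rw [hout] at h5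
  exact (h1.seq (h2.seq (h3.seq (h4.seq h5)))).of_eq rfl (by omega)

/-- **The machine of `swapProg`**: `⟨gs, x⟩ ↦ ⟨x, gs⟩` within `8 |gs| + 7 |x| + 11` steps.
[folklore] -/
theorem exists_machine_swap : ∃ M : TM2ComputableAux Bool Bool, ∀ gs x : List Bool,
    M.OutputsWithin (boolPair gs x) (boolPair x gs) (8 * gs.length + 7 * x.length + 11) := by
  obtain ⟨M, hM⟩ := ACom.exists_computesInTime swapProg .inp .out
    (fun p : List Bool × List Bool => boolPair p.1 p.2)
    (fun p : List Bool × List Bool => boolPair p.1 p.2) Prod.swap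
    (fun p => 8 * p.1.length + 7 * p.2.length + 10)
    (fun p => by rw [single_inp, single_out]; exact runs_swapProg p.1 p.2)
  exact ⟨M, fun gs x => hM (gs, x)⟩

end TCClosure

/-- A polynomial of the length of a pair of numerals is linear in the product of their values:
for every polynomial `p` there is `K` with `p (2 |⌞B⌟| + 2 + |⌞A⌟|) ≤ K · (A · B) + K` whenever
`1 ≤ A` and `1 ≤ B`. [folklore] -/
theorem exists_eval_pairLen_le_mul (p : Polynomial ℕ) : ∃ K : ℕ, ∀ A B : ℕ, 1 ≤ A → 1 ≤ B →
    p.eval (2 * (encodeNat B).length + 2 + (encodeNat A).length) ≤ K * (A * B) + K := by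
  obtain ⟨cp, k, hk⟩ := exists_eval_le_mul_pow_add p
  obtain ⟨C, hC⟩ := TimeConstructible.exists_pow_le_mul_two_pow k
  refine ⟨cp * (3 ^ k * (C * 4)) + cp, fun A B hA hB => ?_⟩
  set ℓ := Nat.log 2 (A * B) with hℓ
  have hAB : A * B ≠ 0 := Nat.mul_ne_zero (by omega) (by omega)
  have hlA : (encodeNat A).length ≤ ℓ + 1 :=
    (TM2Pass.length_encodeNat_le A).trans (Nat.succ_le_succ
      (Nat.log_mono_right (Nat.le_mul_of_pos_right A hB)))
  have hlB : (encodeNat B).length ≤ ℓ + 1 :=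
    (TM2Pass.length_encodeNat_le B).trans (Nat.succ_le_succ
      (Nat.log_mono_right (Nat.le_mul_of_pos_left B hA)))
  have hlen : 2 * (encodeNat B).length + 2 + (encodeNat A).length ≤ 3 * (ℓ + 2) := by omega
  have h2ℓ : 2 ^ ℓ ≤ A * B := Nat.pow_log_le_self 2 hAB
  calc p.eval (2 * (encodeNat B).length + 2 + (encodeNat A).length)
        ≤ cp * (2 * (encodeNat B).length + 2 + (encodeNat A).length) ^ k + cp := hk _
    _ ≤ cp * (3 * (ℓ + 2)) ^ k + cp := by gcongr
    _ = cp * (3 ^ k * (ℓ + 2) ^ k) + cp := by rw [mul_pow]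
    _ ≤ cp * (3 ^ k * (C * 2 ^ (ℓ + 2))) + cp := by gcongr; exact hC _
    _ = cp * (3 ^ k * (C * 4)) * 2 ^ ℓ + cp := by ring
    _ ≤ cp * (3 ^ k * (C * 4)) * (A * B) + cp := by gcongr
    _ ≤ (cp * (3 ^ k * (C * 4)) + cp) * (A * B) + (cp * (3 ^ k * (C * 4)) + cp) := by
        have e : (cp * (3 ^ k * (C * 4)) + cp) * (A * B) =
            cp * (3 ^ k * (C * 4)) * (A * B) + cp * (A * B) := by ring
        rw [e]; omega

/-- **Products**: if `t₁` and `t₂` are time constructible then so is `n ↦ t₁ n · t₂ n` — copy the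
unary input (`UnaryClock.pre`: `1ⁿ ↦ ⟨1ⁿ, 1ⁿ⟩`), run the constructor of `t₁` on the first
component (`mapFstAux`), swap, run the constructor of `t₂` on the first component, and
multiply the two numerals (`Brick.prodFn`, polynomial in their logarithmic length).
[cite: AroraBarakCC2009, §1.3 (p. 16)] -/
theorem IsTimeConstructible.mul {t₁ t₂ : ℕ → ℕ} (h₁ : IsTimeConstructible t₁)
    (h₂ : IsTimeConstructible t₂) : IsTimeConstructible fun n => t₁ n * t₂ n := by
  obtain ⟨hge₁, c₁, M₁, hM₁⟩ := h₁
  obtain ⟨hge₂, c₂, M₂, hM₂⟩ := h₂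
  obtain ⟨Mpre, hpre⟩ := UnaryClock.exists_machine_pre
  obtain ⟨Msw, hsw⟩ := TCClosure.exists_machine_swap
  obtain ⟨p, MP, hMP⟩ := Brick.prodFn_mem_FP
  obtain ⟨K, hK⟩ := exists_eval_pairLen_le_mul p
  -- the running time of the pipeline, as composed
  let Tm : ℕ → ℕ := fun n =>
    (((p.eval (boolPair (encodeNat (t₂ n)) (encodeNat (t₁ n))).length +
      ((c₂ * t₂ n + c₂) + 3 * (encodeNat (t₂ n)).length +
        2 * (boolPair (UnaryClock.un n) (encodeNat (t₁ n))).length + 6)) +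
      (8 * (encodeNat (t₁ n)).length + 7 * (UnaryClock.un n).length + 11)) +
      ((c₁ * t₁ n + c₁) + 3 * (encodeNat (t₁ n)).length +
        2 * (boolPair (UnaryClock.un n) (UnaryClock.un n)).length + 6)) +
      (11 * (UnaryClock.un n).length + 6)
  refine ⟨fun n => ?_, 8 * c₁ + 8 * c₂ + K + 100 + Tm 0,
    Mpre.comp ((mapFstAux M₁).comp (Msw.comp ((mapFstAux M₂).comp MP))), fun n => ?_⟩
  · rcases Nat.eq_zero_or_pos n with rfl | hn
    · exact Nat.zero_le _
    · exact (hge₁ n).trans (Nat.le_mul_of_pos_right _ (hn.trans_le (hge₂ n)))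
  have hl : (unaryEncodeNat n).length = n := unary_decode_encode_nat n
  dsimp only
  rw [hl, UnaryClock.unaryEncodeNat_eq_un]
  -- stage 1: copy
  have h1 : Mpre.OutputsWithin (UnaryClock.un n)
      (boolPair (UnaryClock.un n) (UnaryClock.un n)) (11 * (UnaryClock.un n).length + 6) := by
    have := hpre (UnaryClock.un n)
    simp only [UnaryClock.un, List.length_replicate] at this ⊢
    exact this
  -- stage 2: the constructor of `t₁` on the first component
  have h2 : (mapFstAux M₁).OutputsWithin (boolPair (UnaryClock.un n) (UnaryClock.un n))
      (boolPair (encodeNat (t₁ n)) (UnaryClock.un n))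
      ((c₁ * t₁ n + c₁) + 3 * (encodeNat (t₁ n)).length +
        2 * (boolPair (UnaryClock.un n) (UnaryClock.un n)).length + 6) := by
    have hz : M₁.OutputsWithin (boolUnpair (boolPair (UnaryClock.un n) (UnaryClock.un n))).1
        (encodeNat (t₁ n)) (c₁ * t₁ n + c₁) := by
      have := hM₁ n
      dsimp only at this
      rw [hl, UnaryClock.unaryEncodeNat_eq_un] at this
      simpa using this
    have := outputsWithin_mapFstAux M₁ hz
    rwa [readRest_boolPair] at this
  -- stage 3: swap
  have h3 := hsw (encodeNat (t₁ n)) (UnaryClock.un n)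
  -- stage 4: the constructor of `t₂` on the first component
  have h4 : (mapFstAux M₂).OutputsWithin (boolPair (UnaryClock.un n) (encodeNat (t₁ n)))
      (boolPair (encodeNat (t₂ n)) (encodeNat (t₁ n)))
      ((c₂ * t₂ n + c₂) + 3 * (encodeNat (t₂ n)).length +
        2 * (boolPair (UnaryClock.un n) (encodeNat (t₁ n))).length + 6) := by
    have hz : M₂.OutputsWithin (boolUnpair (boolPair (UnaryClock.un n) (encodeNat (t₁ n)))).1
        (encodeNat (t₂ n)) (c₂ * t₂ n + c₂) := by
      have := hM₂ n
      dsimp only at this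
      rw [hl, UnaryClock.unaryEncodeNat_eq_un] at this
      simpa using this
    have := outputsWithin_mapFstAux M₂ hz
    rwa [readRest_boolPair] at this
  -- stage 5: the product
  have h5 : MP.OutputsWithin (boolPair (encodeNat (t₂ n)) (encodeNat (t₁ n)))
      (encodeNat (t₁ n * t₂ n)) (p.eval (boolPair (encodeNat (t₂ n)) (encodeNat (t₁ n))).length) := by
    have := hMP (boolPair (encodeNat (t₂ n)) (encodeNat (t₁ n)))
    simp only [id, Brick.prodFn_boolPair, bitsToNat_encodeNat] at this
    rwa [Nat.mul_comm] at this
  have h := Turing.TM2ComputableAux.comp_outputsWithin _ _ h1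
    (Turing.TM2ComputableAux.comp_outputsWithin _ _ h2
      (Turing.TM2ComputableAux.comp_outputsWithin _ _ h3
        (Turing.TM2ComputableAux.comp_outputsWithin _ _ h4 h5)))
  have hTm : ∀ m, Tm m = (((p.eval (boolPair (encodeNat (t₂ m)) (encodeNat (t₁ m))).length +
      ((c₂ * t₂ m + c₂) + 3 * (encodeNat (t₂ m)).length +
        2 * (boolPair (UnaryClock.un m) (encodeNat (t₁ m))).length + 6)) +
      (8 * (encodeNat (t₁ m)).length + 7 * (UnaryClock.un m).length + 11)) +
      ((c₁ * t₁ m + c₁) + 3 * (encodeNat (t₁ m)).length +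
        2 * (boolPair (UnaryClock.un m) (UnaryClock.un m)).length + 6)) +
      (11 * (UnaryClock.un m).length + 6) := fun m => rfl
  refine (h.mono (le_of_eq (hTm n).symm)).mono ?_
  -- the bound
  rcases Nat.eq_zero_or_pos n with rfl | hn
  · exact (Nat.le_add_left _ _).trans (Nat.le_add_left _ _)
  have hA1 : 1 ≤ t₁ n := hn.trans_le (hge₁ n)
  have hB1 : 1 ≤ t₂ n := hn.trans_le (hge₂ n)
  have hnA : n ≤ t₁ n := hge₁ n
  have hnB : n ≤ t₂ n := hge₂ n
  have hLA : (encodeNat (t₁ n)).length ≤ t₁ n + 1 := TM2Pass.length_encodeNat_le_self _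
  have hLB : (encodeNat (t₂ n)).length ≤ t₂ n + 1 := TM2Pass.length_encodeNat_le_self _
  have hAAB : t₁ n ≤ t₁ n * t₂ n := Nat.le_mul_of_pos_right _ hB1
  have hBAB : t₂ n ≤ t₁ n * t₂ n := Nat.le_mul_of_pos_left _ hA1
  have hp : p.eval (boolPair (encodeNat (t₂ n)) (encodeNat (t₁ n))).length ≤
      K * (t₁ n * t₂ n) + K := by
    rw [length_boolPair]; exact hK (t₁ n) (t₂ n) hA1 hB1
  have hun : (UnaryClock.un n).length = n := List.length_replicate
  have hp1 : (boolPair (UnaryClock.un n) (encodeNat (t₁ n))).length =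
      2 * n + 2 + (encodeNat (t₁ n)).length := by
    rw [length_boolPair, hun]
  have hp2 : (boolPair (UnaryClock.un n) (UnaryClock.un n)).length = 2 * n + 2 + n := by
    rw [length_boolPair, hun]
  rw [hTm n, hun, hp1, hp2]
  have hc1 : c₁ * t₁ n ≤ c₁ * (t₁ n * t₂ n) := Nat.mul_le_mul_left _ hAAB
  have hc2 : c₂ * t₂ n ≤ c₂ * (t₁ n * t₂ n) := Nat.mul_le_mul_left _ hBAB
  have e : (8 * c₁ + 8 * c₂ + K + 100 + Tm 0) * (t₁ n * t₂ n) =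
      8 * (c₁ * (t₁ n * t₂ n)) + 8 * (c₂ * (t₁ n * t₂ n)) + K * (t₁ n * t₂ n) +
        100 * (t₁ n * t₂ n) + Tm 0 * (t₁ n * t₂ n) := by
    ring
  have hABpos : 0 ≤ Tm 0 * (t₁ n * t₂ n) := Nat.zero_le _
  omega

end Literature.Computability.Complexity
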